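import Mathlib.Analysis.SpecialFunctions.Pow.Real
import Mathlib.Analysis.SpecialFunctions.Sqrt
import Mathlib.Analysis.InnerProductSpace.PiL2
import Mathlib.Analysis.Calculus.MeanValue
import Mathlib.Topology.MetricSpace.Cauchy
import Mathlib.Analysis.SpecialFunctions.Integrals.Basic
import Literature.Geometry.Lorentzian.Basic

/-!
# Route EIHFluxBalance — `InertialRecession`, line `old-light-leaves-the-cone`: charge kinematics, I
(basic real analysis for the endgame `stub_expandingChargeKinematics`)

Helper file for the crux `stmt-FinalStateConjecture-10166`
(`Summit.FinalStateConjecture.FinalStateConjecture.Theses.EIHFluxBalance.InertialRecession`),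
second line lead. The endgame stub S4 of the line turns quasi-conserved abstract window charges into
Cesàro velocities of the painted centres. This file collects the Mathlib-only bricks every version
of that argument uses:

* `exists_tendsto_of_abs_sub_le` / `exists_tendsto_of_norm_sub_le` — convergence at `atTop` from a
  Cauchy condition WITH SLACK (`∀ ε, ∃ T, ∀ T ≤ t₁ ≤ t₂, |f t₂ − f t₁| ≤ ε`), the form in which a
  window law `|ΔP| ≤ C∫(R⁻² + R^{-7/4}) + η(t₁)` delivers convergence along a path of radius `R ≍ t`;
* the Lorentz-factor algebra on the ball `‖v‖ ≤ k < 1`: `one_le_gammaFactor`, bounds, continuity, and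
  the recovery of the velocity from the four-momentum `(γ, γv)` (`tendsto_of_tendsto_gamma_smul`);
* `cesaro_of_tendsto_deriv` / `cesaro_of_slaved` — a convergent (slaving) velocity is a Cesàro velocity
  (`ξ̇ − v → 0`, `v → V` ⇒ `ξ(t)/t → V`);
* `exists_forall_norm_sub_le_two_mul` — eventually `2`-Lipschitz centres from slaving;
* the two tail integrals `∫_{t₁}^{t₂} (c s)⁻² ≤ (c² t₁)⁻¹` and `∫_{t₁}^{t₂} (c s)^{-7/4} ≤ (4/3) c^{-7/4} t₁^{-3/4}`.

The Cesàro lemmas and the Lorentz-factor positivity are stated for a general real normed space (the sibling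
line's `Theorems.EIHFluxBalanceInertialRecessionStubEndgameBasics` has the `E3` specialisations
`tendsto_inv_smul_of_tendsto_deriv`, `tendsto_inv_smul_of_slaved`, `one_le_inv_sqrt_one_sub_sq`; this series is
kept import-independent of it so that the two endgames can land in either order).
No Theses declaration is asserted; everything is [folklore] real analysis.
-/

set_option linter.dupNamespace false

noncomputable section

open Filter Set Metric Real
open scoped Topology

namespace Summit.FinalStateConjecture.FinalStateConjecture.Theorems.ChargeKinematics

open Literature.Geometry.Lorentzian

/-! ## Convergence from a Cauchy condition with slack -/

/-- A real function which is Cauchy at `+∞` in the slack form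
`∀ ε > 0, ∃ T, ∀ T ≤ t₁ ≤ t₂, |f t₂ - f t₁| ≤ ε` converges. [folklore] -/
theorem exists_tendsto_of_abs_sub_le {f : ℝ → ℝ}
    (h : ∀ ε > 0, ∃ T, ∀ t₁ t₂, T ≤ t₁ → t₁ ≤ t₂ → |f t₂ - f t₁| ≤ ε) :
    ∃ L, Tendsto f atTop (𝓝 L) := by
  have hc : CauchySeq f := by
    rw [Metric.cauchySeq_iff']
    intro ε hε
    obtain ⟨T, hT⟩ := h (ε / 2) (half_pos hε)
    refine ⟨T, fun t ht ↦ ?_⟩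
    rw [Real.dist_eq]
    exact (hT T t le_rfl ht).trans_lt (half_lt_self hε)
  exact cauchySeq_tendsto_of_complete hc

/-- Normed-group version of `exists_tendsto_of_abs_sub_le`. [folklore] -/
theorem exists_tendsto_of_norm_sub_le {E : Type*} [NormedAddCommGroup E] [CompleteSpace E]
    {f : ℝ → E} (h : ∀ ε > 0, ∃ T, ∀ t₁ t₂, T ≤ t₁ → t₁ ≤ t₂ → ‖f t₂ - f t₁‖ ≤ ε) :
    ∃ L, Tendsto f atTop (𝓝 L) := by
  have hc : CauchySeq f := by
    rw [Metric.cauchySeq_iff']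
    intro ε hε
    obtain ⟨T, hT⟩ := h (ε / 2) (half_pos hε)
    refine ⟨T, fun t ht ↦ ?_⟩
    rw [dist_eq_norm]
    exact (hT T t le_rfl ht).trans_lt (half_lt_self hε)
  exact cauchySeq_tendsto_of_complete hc

/-! ## Lorentz-factor algebra on `‖v‖ ≤ k < 1` -/

/-- For `‖v‖ < 1` the radicand `1 - ‖v‖²` is positive (any real normed space). [folklore] -/
theorem one_sub_norm_sq_pos {E : Type*} [NormedAddCommGroup E] {v : E} (hv : ‖v‖ < 1) :
    0 < 1 - ‖v‖ ^ 2 := by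
  have h0 : 0 ≤ ‖v‖ := norm_nonneg v
  nlinarith

/-- The Lorentz factor `γ(v) = (√(1 − ‖v‖²))⁻¹` is at least `1` for `‖v‖ < 1` (any real normed space).
[folklore] -/
theorem one_le_gammaFactor {E : Type*} [NormedAddCommGroup E] {v : E} (hv : ‖v‖ < 1) :
    1 ≤ (√(1 - ‖v‖ ^ 2))⁻¹ := by
  have hpos := one_sub_norm_sq_pos hv
  rw [le_inv_comm₀ one_pos (Real.sqrt_pos.mpr hpos), inv_one, Real.sqrt_le_one]
  nlinarith [norm_nonneg v]

/-- The Lorentz factor is positive for `‖v‖ < 1`. [folklore] -/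
theorem gammaFactor_pos {v : E3} (hv : ‖v‖ < 1) : 0 < (√(1 - ‖v‖ ^ 2))⁻¹ :=
  one_pos.trans_le (one_le_gammaFactor hv)

/-- Monotone bound: `‖v‖ ≤ k < 1` gives `γ(v) ≤ γ(k) = (√(1 − k²))⁻¹`. [folklore] -/
theorem gammaFactor_le {v : E3} {k : ℝ} (hv : ‖v‖ ≤ k) (hk : k < 1) :
    (√(1 - ‖v‖ ^ 2))⁻¹ ≤ (√(1 - k ^ 2))⁻¹ := by
  have h0 : 0 ≤ ‖v‖ := norm_nonneg v
  have hk0 : 0 ≤ k := h0.trans hv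
  have hkpos : 0 < 1 - k ^ 2 := by nlinarith
  have hvpos : 0 < 1 - ‖v‖ ^ 2 := by nlinarith
  apply inv_anti₀ (Real.sqrt_pos.mpr hkpos)
  apply Real.sqrt_le_sqrt
  nlinarith

/-- The Lorentz factor is continuous on the open unit ball. [folklore] -/
theorem continuousOn_gammaFactor :
    ContinuousOn (fun v : E3 ↦ (√(1 - ‖v‖ ^ 2))⁻¹) (Metric.ball 0 1) := by
  refine ContinuousOn.inv₀ ?_ fun v hv ↦ ?_
  · exact ((continuous_const.sub (continuous_norm.pow 2)).sqrt).continuousOn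
  · rw [mem_ball_zero_iff] at hv
    exact (Real.sqrt_pos.mpr (one_sub_norm_sq_pos hv)).ne'

/-- Along a path that stays in `‖v‖ ≤ k < 1`, the Lorentz factor is continuous in time when the
velocity is. [folklore] -/
theorem continuous_gammaFactor_comp {v : ℝ → E3} {k : ℝ} (hv : Continuous v)
    (hk : k < 1) (hvk : ∀ t, ‖v t‖ ≤ k) :
    Continuous fun t ↦ (√(1 - ‖v t‖ ^ 2))⁻¹ := by
  have hin : ∀ t, v t ∈ Metric.ball (0 : E3) 1 := fun t ↦ by
    rw [mem_ball_zero_iff]; exact (hvk t).trans_lt hk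
  exact continuousOn_gammaFactor.comp_continuous hv hin

/-- **Recovering the velocity from the four-momentum.** If `γ(v(t)) → E` and
`γ(v(t)) • v(t) → p` with `E ≠ 0`, then `v(t) → E⁻¹ • p`. [folklore] -/
theorem tendsto_of_tendsto_gamma_smul {v : ℝ → E3} {γ : ℝ → ℝ} {E : ℝ} {p : E3}
    (hγ : Tendsto γ atTop (𝓝 E)) (hp : Tendsto (fun t ↦ γ t • v t) atTop (𝓝 p)) (hE : E ≠ 0)
    (hγ0 : ∀ᶠ t in atTop, γ t ≠ 0) :
    Tendsto v atTop (𝓝 (E⁻¹ • p)) := by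
  have h := (hγ.inv₀ hE).smul hp
  refine h.congr' ?_
  filter_upwards [hγ0] with t ht
  rw [smul_smul, inv_mul_cancel₀ ht, one_smul]

/-- Coordinatewise convergence in `E3` gives convergence. [folklore] -/
theorem tendsto_of_forall_coord {v : ℝ → E3} {V : E3}
    (h : ∀ k : Fin 3, Tendsto (fun t ↦ v t k) atTop (𝓝 (V k))) : Tendsto v atTop (𝓝 V) := by
  have h1 : Tendsto (fun t ↦ (EuclideanSpace.equiv (Fin 3) ℝ) (v t)) atTop
      (𝓝 ((EuclideanSpace.equiv (Fin 3) ℝ) V)) := by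
    rw [tendsto_pi_nhds]
    exact h
  have h2 := ((EuclideanSpace.equiv (Fin 3) ℝ).symm.continuous.tendsto _).comp h1
  rw [ContinuousLinearEquiv.symm_apply_apply] at h2
  exact h2.congr fun t ↦ by simp

/-! ## Cesàro velocity from a convergent (slaving) velocity -/

/-- If `f : ℝ → E` is differentiable and `f′(t) → V` as `t → ∞`, then `t⁻¹ • f(t) → V` (any real normed space;
mean-value inequality on `[T₁, t]` applied to `f − (·)•V`). [folklore] -/
theorem cesaro_of_tendsto_deriv {E : Type*} [NormedAddCommGroup E] [NormedSpace ℝ E] {f : ℝ → E} {V : E}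
    (hf : Differentiable ℝ f) (h : Tendsto (deriv f) atTop (𝓝 V)) :
    Tendsto (fun t : ℝ ↦ t⁻¹ • f t) atTop (𝓝 V) := by
  rw [Metric.tendsto_atTop] at h ⊢
  intro ε hε
  obtain ⟨T₀, hT₀⟩ := h (ε / 2) (half_pos hε)
  obtain ⟨T₁, hT₁0, hT₁⟩ : ∃ T₁ : ℝ, 0 ≤ T₁ ∧ ∀ s, T₁ ≤ s → ‖deriv f s - V‖ < ε / 2 :=
    ⟨max T₀ 0, le_max_right _ _, fun s hs ↦ by
      rw [← dist_eq_norm]; exact hT₀ s ((le_max_left _ _).trans hs)⟩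
  have hgd : ∀ s, HasDerivAt (fun s : ℝ ↦ f s - s • V) (deriv f s - V) s := fun s ↦ by
    have h1 : HasDerivAt f (deriv f s) s := (hf s).hasDerivAt
    have h2 : HasDerivAt (fun s : ℝ ↦ s • V) ((1 : ℝ) • V) s := (hasDerivAt_id s).smul_const V
    have h3 := h1.sub h2
    rw [one_smul] at h3
    exact h3
  have hseg : ∀ t, T₁ ≤ t →
      ‖(f t - t • V) - (f T₁ - T₁ • V)‖ ≤ ε / 2 * (t - T₁) := by
    intro t ht
    exact norm_image_sub_le_of_norm_deriv_le_segment' (f := fun s : ℝ ↦ f s - s • V) (a := T₁)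
      (b := t) (fun s _ ↦ (hgd s).hasDerivWithinAt) (fun s hs ↦ le_of_lt (hT₁ s hs.1)) t
      (right_mem_Icc.mpr ht)
  refine ⟨max (T₁ + 1) (2 * ‖f T₁ - T₁ • V‖ / ε + 1), fun t ht ↦ ?_⟩
  have ht1 : T₁ + 1 ≤ t := (le_max_left _ _).trans ht
  have ht₁ : T₁ ≤ t := by linarith
  have htK : 2 * ‖f T₁ - T₁ • V‖ / ε + 1 ≤ t := (le_max_right _ _).trans ht
  have htpos : 0 < t := by linarith
  have hKt : ‖f T₁ - T₁ • V‖ < ε / 2 * t := by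
    have h1 : 2 * ‖f T₁ - T₁ • V‖ / ε < t := by linarith
    have h2 := (div_lt_iff₀ hε).mp h1
    linarith
  have hgt : ‖f t - t • V‖ ≤ ε / 2 * (t - T₁) + ‖f T₁ - T₁ • V‖ := by
    calc ‖f t - t • V‖ = ‖((f t - t • V) - (f T₁ - T₁ • V)) + (f T₁ - T₁ • V)‖ := by
          rw [sub_add_cancel]
      _ ≤ ‖(f t - t • V) - (f T₁ - T₁ • V)‖ + ‖f T₁ - T₁ • V‖ := norm_add_le _ _
      _ ≤ ε / 2 * (t - T₁) + ‖f T₁ - T₁ • V‖ := by linarith [hseg t ht₁]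
  have hgt' : ‖f t - t • V‖ < ε * t := by
    have hmono : ε / 2 * (t - T₁) ≤ ε / 2 * t :=
      mul_le_mul_of_nonneg_left (by linarith) (le_of_lt (half_pos hε))
    linarith
  have hid : t⁻¹ • f t - V = t⁻¹ • (f t - t • V) := by
    rw [smul_sub, smul_smul, inv_mul_cancel₀ htpos.ne', one_smul]
  rw [dist_eq_norm, hid, norm_smul, norm_inv, Real.norm_eq_abs, abs_of_pos htpos]
  calc t⁻¹ * ‖f t - t • V‖ < t⁻¹ * (ε * t) := mul_lt_mul_of_pos_left hgt' (inv_pos.mpr htpos)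
    _ = ε := by rw [mul_comm ε t, inv_mul_cancel_left₀ htpos.ne']

/-- **A convergent slaving velocity is a Cesàro velocity** (any real normed space): `ξ` differentiable,
`ξ̇ − v → 0` and `v → V` give `t⁻¹ • ξ(t) → V`. [folklore] -/
theorem cesaro_of_slaved {E : Type*} [NormedAddCommGroup E] [NormedSpace ℝ E] {ξ v : ℝ → E} {V : E}
    (hξ : Differentiable ℝ ξ) (hslave : Tendsto (fun t ↦ deriv ξ t - v t) atTop (𝓝 0))
    (hv : Tendsto v atTop (𝓝 V)) : Tendsto (fun t : ℝ ↦ t⁻¹ • ξ t) atTop (𝓝 V) := by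
  refine cesaro_of_tendsto_deriv hξ ?_
  have h := hslave.add hv
  simp only [sub_add_cancel, zero_add] at h
  exact h

/-! ## Eventually `2`-Lipschitz centres from slaving -/

/-- If `ξ` is differentiable with `‖ξ'‖ ≤ 2` on `[T, ∞)`, then `ξ` is `2`-Lipschitz there.
[folklore] -/
theorem norm_sub_le_two_mul_of_norm_deriv_le {ξ : ℝ → E3} {T : ℝ} (hξ : Differentiable ℝ ξ)
    (hd : ∀ s, T ≤ s → ‖deriv ξ s‖ ≤ 2) {s s' : ℝ} (hs : T ≤ s) (hs' : T ≤ s') :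
    ‖ξ s - ξ s'‖ ≤ 2 * |s - s'| := by
  wlog hle : s' ≤ s generalizing s s'
  · have := this hs' hs (le_of_not_ge hle)
    rwa [norm_sub_rev, abs_sub_comm] at this
  have key := norm_image_sub_le_of_norm_deriv_le_segment' (f := ξ) (a := s') (b := s) (C := 2)
    (fun x _ ↦ (hξ x).hasDerivAt.hasDerivWithinAt) (fun x hx ↦ hd x (hs'.trans hx.1)) s
    (right_mem_Icc.mpr hle)
  rwa [abs_of_nonneg (sub_nonneg.mpr hle)]

/-- **Slaving makes the centres eventually `2`-Lipschitz**: from `ξ̇ − v → 0` and an eventual speed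
bound `‖v‖ ≤ k < 1` (indeed `k ≤ 1` suffices) there is `T` with `‖ξ(s) − ξ(s′)‖ ≤ 2|s − s′|` for
`s, s′ ≥ T`. [folklore] -/
theorem exists_forall_norm_sub_le_two_mul {ξ v : ℝ → E3} {k : ℝ} (hξ : Differentiable ℝ ξ)
    (hslave : Tendsto (fun t ↦ deriv ξ t - v t) atTop (𝓝 0)) (hk : k ≤ 1)
    (hvk : ∀ᶠ t in atTop, ‖v t‖ ≤ k) :
    ∃ T, ∀ s s', T ≤ s → T ≤ s' → ‖ξ s - ξ s'‖ ≤ 2 * |s - s'| := by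
  have h1 : ∀ᶠ t in atTop, ‖deriv ξ t - v t‖ < 1 := by
    have h := hslave.norm
    rw [norm_zero] at h
    exact h.eventually (gt_mem_nhds one_pos)
  obtain ⟨T, hT⟩ := eventually_atTop.mp (h1.and hvk)
  refine ⟨T, fun s s' hs hs' ↦ norm_sub_le_two_mul_of_norm_deriv_le hξ (fun x hx ↦ ?_) hs hs'⟩
  obtain ⟨hx1, hx2⟩ := hT x hx
  calc ‖deriv ξ x‖ = ‖(deriv ξ x - v x) + v x‖ := by rw [sub_add_cancel]
    _ ≤ ‖deriv ξ x - v x‖ + ‖v x‖ := norm_add_le _ _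
    _ ≤ 1 + k := by linarith [hx1.le]
    _ ≤ 2 := by linarith

/-! ## The two tail integrals of the window budget along `R = c s` -/

/-- `∫_{t₁}^{t₂} ((c s)²)⁻¹ ds ≤ (c² t₁)⁻¹` for `0 < c`, `0 < t₁ ≤ t₂`. [folklore] -/
theorem integral_inv_sq_mul_le {c t₁ t₂ : ℝ} (hc : 0 < c) (ht₁ : 0 < t₁) (h : t₁ ≤ t₂) :
    ∫ s in t₁..t₂, ((c * s) ^ 2)⁻¹ ≤ (c ^ 2 * t₁)⁻¹ := by
  have ht₂ : 0 < t₂ := ht₁.trans_le h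
  have hfun : (fun s : ℝ ↦ ((c * s) ^ 2)⁻¹) = fun s ↦ (c ^ 2)⁻¹ * s ^ (-2 : ℤ) := by
    funext s
    rw [mul_pow, mul_inv, zpow_neg, zpow_ofNat]
  rw [hfun, intervalIntegral.integral_const_mul]
  have hint : ∫ s in t₁..t₂, s ^ (-2 : ℤ) = (t₂ ^ (-1 : ℤ) - t₁ ^ (-1 : ℤ)) / (-1) := by
    have h0 : (0 : ℝ) ∉ Set.uIcc t₁ t₂ := by
      rw [Set.uIcc_of_le h]; exact fun hx ↦ by linarith [hx.1]
    have := integral_zpow (n := -2) (a := t₁) (b := t₂) (Or.inr ⟨by norm_num, h0⟩)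
    norm_num at this ⊢
    linarith [this]
  rw [hint]
  have h1 : t₂ ^ (-1 : ℤ) = t₂⁻¹ := by simp
  have h2 : t₁ ^ (-1 : ℤ) = t₁⁻¹ := by simp
  rw [h1, h2]
  have hc2 : 0 < c ^ 2 := by positivity
  rw [mul_inv, show (t₂⁻¹ - t₁⁻¹) / (-1 : ℝ) = t₁⁻¹ - t₂⁻¹ by ring]
  have : 0 ≤ t₂⁻¹ := by positivity
  nlinarith [inv_pos.mpr hc2]

/-- `∫_{t₁}^{t₂} ((c s)^{7/4})⁻¹ ds ≤ (4/3) c^{-7/4} t₁^{-3/4}` for `0 < c`, `0 < t₁ ≤ t₂`. [folklore] -/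
theorem integral_inv_rpow_mul_le {c t₁ t₂ : ℝ} (hc : 0 < c) (ht₁ : 0 < t₁) (h : t₁ ≤ t₂) :
    ∫ s in t₁..t₂, ((c * s) ^ (7 / 4 : ℝ))⁻¹ ≤
      4 / 3 * c ^ (-(7 / 4) : ℝ) * t₁ ^ (-(3 / 4) : ℝ) := by
  have ht₂ : 0 < t₂ := ht₁.trans_le h
  have hfun : Set.EqOn (fun s : ℝ ↦ ((c * s) ^ (7 / 4 : ℝ))⁻¹)
      (fun s ↦ c ^ (-(7 / 4) : ℝ) * s ^ (-(7 / 4) : ℝ)) (Set.uIcc t₁ t₂) := by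
    intro s hs
    rw [Set.uIcc_of_le h] at hs
    have hs0 : 0 ≤ s := ht₁.le.trans hs.1
    simp only
    rw [Real.mul_rpow hc.le hs0, mul_inv, Real.rpow_neg hc.le, Real.rpow_neg hs0]
  rw [intervalIntegral.integral_congr hfun, intervalIntegral.integral_const_mul]
  have h0 : (0 : ℝ) ∉ Set.uIcc t₁ t₂ := by
    rw [Set.uIcc_of_le h]; exact fun hx ↦ by linarith [hx.1]
  have hint := integral_rpow (a := t₁) (b := t₂) (r := -(7 / 4 : ℝ)) (Or.inr ⟨by norm_num, h0⟩)
  rw [hint]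
  have hcpow : 0 < c ^ (-(7 / 4) : ℝ) := Real.rpow_pos_of_pos hc _
  have h3 : -(7 / 4 : ℝ) + 1 = -(3 / 4) := by norm_num
  rw [h3]
  have hA : 0 ≤ t₂ ^ (-(3 / 4) : ℝ) := Real.rpow_nonneg ht₂.le _
  have hB : 0 ≤ t₁ ^ (-(3 / 4) : ℝ) := Real.rpow_nonneg ht₁.le _
  have key : (t₂ ^ (-(3 / 4) : ℝ) - t₁ ^ (-(3 / 4) : ℝ)) / (-(3 / 4) : ℝ) ≤
      4 / 3 * t₁ ^ (-(3 / 4) : ℝ) := by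
    rw [div_neg, neg_le, neg_mul_eq_neg_mul]
    rw [le_div_iff₀ (by norm_num : (0 : ℝ) < 3 / 4)]
    nlinarith
  calc c ^ (-(7 / 4) : ℝ) * ((t₂ ^ (-(3 / 4) : ℝ) - t₁ ^ (-(3 / 4) : ℝ)) / (-(3 / 4) : ℝ))
      ≤ c ^ (-(7 / 4) : ℝ) * (4 / 3 * t₁ ^ (-(3 / 4) : ℝ)) :=
        mul_le_mul_of_nonneg_left key hcpow.le
    _ = 4 / 3 * c ^ (-(7 / 4) : ℝ) * t₁ ^ (-(3 / 4) : ℝ) := by ring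

end Summit.FinalStateConjecture.FinalStateConjecture.Theorems.ChargeKinematics

namespace Summit.FinalStateConjecture.FinalStateConjecture.Theorems

/-- REGISTERED STUB `integral_inv_sq_mul_le` of the crux item stmt-FinalStateConjecture-10166 (second line lead, line
`old-light-leaves-the-cone`, S4 helper series): the registered one-line signature verbatim, discharged by
`ChargeKinematics.integral_inv_sq_mul_le`. [folklore] -/
theorem integral_inv_sq_mul_le : open Literature.Geometry.Lorentzian Filter Topology MeasureTheory intervalIntegral in ∀ {c t₁ t₂ : ℝ} (hc : 0 < c) (ht₁ : 0 < t₁) (h : t₁ ≤ t₂), ∫ s in t₁..t₂, ((c * s) ^ 2)⁻¹ ≤ (c ^ 2 * t₁)⁻¹ :=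
  @ChargeKinematics.integral_inv_sq_mul_le

end Summit.FinalStateConjecture.FinalStateConjecture.Theorems

end
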